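import Mathlib
import Summits.ValiantsHypothesis.ValiantsHypothesis.Theses.LiouvilleSarnak
import Summits.ValiantsHypothesis.ValiantsHypothesis.Theorems.LiouvilleSarnakLiouvilleCutRankOneBlockEmbedding

/-!
# Route LiouvilleSarnak — crux `LiouvilleCutRank` (stmt-ValiantsHypothesis-14775):
# ONE GOOD ALIGNED BLOCK PER CUT WORD SUFFICES

The crux `LiouvilleCutRank`: for every `W`, eventually EVERY balanced cut matrix
`M_π(r, c) = λ(N_π(r, c) + 1)` (`π : Fin n ⊕ Fin n ≃ Fin (2n)`, `λ` = Liouville,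
`N_π(r, c) = Nat.ofBits (Sum.elim r c ∘ π.symm)`) has rank `≥ W`.  The registered line `one_scale`
collapsed it to ONE scale (`OneScale.liouvilleCutRank_iff_rankAtOneScale`:
`∀ W ∃ n₁ ∀ π₁, W ≤ rank M_{π₁}`).  With the SHIFTED window embedding and the balanced window with
a top margin of `Theorems/LiouvilleSarnakLiouvilleCutRankOneBlockEmbedding.lean` (bits above the
window frozen to the digits of an arbitrary `H`), the open content weakens further:

* §3 `liouvilleCutRank_iff_oneBlock` — ★ the crux is EQUIVALENT to its ONE-BLOCK form
  `∀ W, ∃ n₁, ∀ π₁ (balanced cut at level n₁), ∃ H, W ≤ rank (λ(N_{π₁}(r,c) + 4^{n₁} H + 1))_{r,c}`: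
  for every cut word at one scale it is enough that SOME aligned block of `λ` of length `4^{n₁}`,
  ANYWHERE in the sequence, has `π₁`-rank `≥ W` (finitely many `π₁` ⇒ a uniform bound `B < 2^B`
  on the shifts; margin `T = B`; levels `n ≥ (n₁ + 1)(n₁ + B)`).  `∀ H` (all aligned blocks flat
  through one cut word per scale) is what a counterexample to the crux must supply; `∃ H` (one
  rich block) is what a proof needs — the form in which averaged / almost-all statements about
  `λ` can enter, instead of statements about the initial segment `[1, 4^n]` only.
* §4 `liouvilleCutRank_iff_oneBlock_distinctRows` — the same in pattern-counting currency: the crux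
  holds iff for every `D` there is a scale `n₁` such that for every balanced cut `π₁` at that scale
  SOME aligned `4^{n₁}`-block of `λ` shows `≥ D` distinct row patterns
  `c ↦ λ(4^{n₁} H + N_{π₁}(r, c) + 1)` (a `±1` matrix with `R` distinct rows has
  `R ≤ 2^{rank}`, tree lemma `LiouvilleSarnakAligned.card_image_row_le_two_pow_rank`, and
  `rank ≤ R`).

Honest framing: structural (the number theory of the crux is untouched); `LiouvilleCutRank` (every
`W`; rungs `W ≤ 64` are in the tree), `DigitalBilinearLiouville` and `AlgebraicSarnak` stay OPEN, and
nothing here bears on VP versus VNP.  No definitions (the one-block form is written out verbatim).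
-/

-- the directory `ValiantsHypothesis/ValiantsHypothesis` repeats the summit name (tree layout)
set_option linter.dupNamespace false

namespace Summit.ValiantsHypothesis.ValiantsHypothesis.Theorems.LiouvilleSarnakLiouvilleCutRank.OneBlock

open ArithmeticFunction

open Summit.ValiantsHypothesis.ValiantsHypothesis.Theses.LiouvilleSarnak (LiouvilleCutRank)
open Summit.ValiantsHypothesis.ValiantsHypothesis.Theorems.LiouvilleSarnakAligned
  (card_image_row_le_two_pow_rank)
open Summit.ValiantsHypothesis.ValiantsHypothesis.Theorems.LiouvilleSarnakLiouvilleCutRank.OneScale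
  (exists_inducedCut)

/-! ### §3 One good block per cut word suffices -/

/-- **Scale transfer with shifts.**  If for every balanced cut `π₁` at level `n₁` SOME aligned block
`[4^{n₁} H + 1, 4^{n₁}(H + 1)]` of `λ` with `H < 2^T` has `π₁`-rank `≥ W`, then every balanced cut
matrix at every level `n ≥ (n₁ + 1)(n₁ + T)` has rank `≥ W`: a balanced `2n₁`-window with `T` free
positions above it exists (§1), and the induced cut `π₁` embeds with every shift `H < 2^T` (§2).
[folklore] -/
theorem le_rank_of_oneBlock (W n₁ T : ℕ)
    (h : ∀ π₁ : Fin n₁ ⊕ Fin n₁ ≃ Fin (2 * n₁), ∃ H < 2 ^ T,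
      W ≤ (Matrix.of fun r c : Fin n₁ → Bool =>
        (((liouville (Nat.ofBits (fun j : Fin (2 * n₁) => Sum.elim r c (π₁.symm j)) +
          2 ^ (2 * n₁) * H + 1) : ℤ) : ℂ))).rank)
    (n : ℕ) (hn : (n₁ + 1) * (n₁ + T) ≤ n) (π : Fin n ⊕ Fin n ≃ Fin (2 * n)) :
    W ≤ (Matrix.of fun r c : Fin n → Bool =>
      (((liouville (Nat.ofBits (fun j : Fin (2 * n) => Sum.elim r c (π.symm j)) + 1) : ℤ) :
        ℂ))).rank := by
  let w : ℕ → Bool := fun k => if hk : k < 2 * n then (π.symm ⟨k, hk⟩).isLeft else false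
  have hw : ∀ j : Fin (2 * n), w j = (π.symm j).isLeft := fun j => by simp [w, j.isLt]
  obtain ⟨s, hs, hcount⟩ := exists_balancedWindow_margin n₁ T n hn π w hw
  obtain ⟨π₁, hπ₁⟩ := exists_inducedCut n₁ s w hcount
  obtain ⟨H, hHT, hW⟩ := h π₁
  have hH : H < 2 ^ (2 * n - (s + 2 * n₁)) :=
    lt_of_lt_of_le hHT (Nat.pow_le_pow_right Nat.two_pos (by omega))
  exact hW.trans (rank_inducedCut_shift_le n₁ n π w s (by omega) (fun j _ _ => hw j) π₁ hπ₁ H hH)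

/-- **One-block form ⇒ crux.**  If for every `W` there is a scale `n₁` at which every balanced cut
`π₁` sees rank `≥ W` in SOME aligned `4^{n₁}`-block of `λ` (shift `H` depending on `π₁`), then
`LiouvilleCutRank` holds: there are finitely many `π₁`, so the shifts are bounded by some `B < 2^B`,
and `le_rank_of_oneBlock` applies with margin `T = B` from level `(n₁ + 1)(n₁ + B)` on. [folklore] -/
theorem liouvilleCutRank_of_oneBlock
    (h : ∀ W : ℕ, ∃ n₁ : ℕ, ∀ π₁ : Fin n₁ ⊕ Fin n₁ ≃ Fin (2 * n₁), ∃ H : ℕ,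
      W ≤ (Matrix.of fun r c : Fin n₁ → Bool =>
        (((liouville (Nat.ofBits (fun j : Fin (2 * n₁) => Sum.elim r c (π₁.symm j)) +
          2 ^ (2 * n₁) * H + 1) : ℤ) : ℂ))).rank) :
    LiouvilleCutRank := by
  intro W
  obtain ⟨n₁, hn₁⟩ := h W
  choose f hf using hn₁
  obtain ⟨B, hB⟩ := (Set.finite_range f).bddAbove
  refine ⟨(n₁ + 1) * (n₁ + B), fun n hn π => ?_⟩
  exact le_rank_of_oneBlock W n₁ B
    (fun π₁ => ⟨f π₁, lt_of_le_of_lt (hB (Set.mem_range_self π₁)) Nat.lt_two_pow_self, hf π₁⟩)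
    n hn π

/-- **Crux ⇒ one-block form** (trivial direction: the block `H = 0` at the level `n₀` of the crux).
[folklore] -/
theorem oneBlock_of_liouvilleCutRank (h : LiouvilleCutRank) :
    ∀ W : ℕ, ∃ n₁ : ℕ, ∀ π₁ : Fin n₁ ⊕ Fin n₁ ≃ Fin (2 * n₁), ∃ H : ℕ,
      W ≤ (Matrix.of fun r c : Fin n₁ → Bool =>
        (((liouville (Nat.ofBits (fun j : Fin (2 * n₁) => Sum.elim r c (π₁.symm j)) +
          2 ^ (2 * n₁) * H + 1) : ℤ) : ℂ))).rank := by
  intro W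
  obtain ⟨n₀, hn₀⟩ := h W
  refine ⟨n₀, fun π₁ => ⟨0, ?_⟩⟩
  simpa using hn₀ n₀ le_rfl π₁

/-- ★ **`LiouvilleCutRank` ⟺ its ONE-BLOCK form.**  The crux (for every `W`, eventually every
balanced cut matrix of `λ` has rank `≥ W`) holds iff for every `W` there is ONE scale `n₁` such
that for every balanced cut `π₁` of `2n₁` positions SOME aligned block `[4^{n₁} H + 1, 4^{n₁}(H+1)]`
of the Liouville sequence, read through `π₁` as a `2^{n₁} × 2^{n₁}` sign matrix
`(λ(N_{π₁}(r, c) + 4^{n₁} H + 1))_{r,c}`, has rank `≥ W`.  A counterexample to the crux must make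
EVERY aligned block flat for some cut word at every scale; a proof needs only ONE rich block per
cut word. [folklore] -/
theorem liouvilleCutRank_iff_oneBlock :
    LiouvilleCutRank ↔
      ∀ W : ℕ, ∃ n₁ : ℕ, ∀ π₁ : Fin n₁ ⊕ Fin n₁ ≃ Fin (2 * n₁), ∃ H : ℕ,
        W ≤ (Matrix.of fun r c : Fin n₁ → Bool =>
          (((liouville (Nat.ofBits (fun j : Fin (2 * n₁) => Sum.elim r c (π₁.symm j)) +
            2 ^ (2 * n₁) * H + 1) : ℤ) : ℂ))).rank :=
  ⟨oneBlock_of_liouvilleCutRank, liouvilleCutRank_of_oneBlock⟩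

/-! ### §4 The same in pattern-counting currency -/

/-- The rank of a matrix over a field is at most its number of distinct rows (the rows span the
row space). [folklore] -/
theorem rank_le_card_image_row {K : Type*} [Field K] {m n : Type*} [Fintype m] [Fintype n]
    [DecidableEq (n → K)] (A : Matrix m n K) :
    A.rank ≤ (Finset.univ.image fun i : m => A i).card := by
  classical
  rw [Matrix.rank_eq_finrank_span_row]
  have hrange : Set.range A.row = ((Finset.univ.image fun i : m => A i : Finset (n → K)) :
      Set (n → K)) := by
    ext v
    simp [Matrix.row]
  rw [hrange]
  exact finrank_span_finset_le_card _

/-- The entries of a shifted cut matrix `(λ(N_{π₁}(r, c) + 4^{n₁} H + 1))` are `±1`. [folklore] -/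
theorem blockMatrix_entry_eq_or (n₁ H : ℕ) (π₁ : Fin n₁ ⊕ Fin n₁ ≃ Fin (2 * n₁))
    (r c : Fin n₁ → Bool) :
    (Matrix.of fun r c : Fin n₁ → Bool =>
        (((liouville (Nat.ofBits (fun j : Fin (2 * n₁) => Sum.elim r c (π₁.symm j)) +
          2 ^ (2 * n₁) * H + 1) : ℤ) : ℂ))) r c = 1 ∨
      (Matrix.of fun r c : Fin n₁ → Bool =>
        (((liouville (Nat.ofBits (fun j : Fin (2 * n₁) => Sum.elim r c (π₁.symm j)) +
          2 ^ (2 * n₁) * H + 1) : ℤ) : ℂ))) r c = -1 := by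
  rw [Matrix.of_apply, liouville_apply (Nat.succ_ne_zero _)]
  rcases neg_one_pow_eq_or ℤ
      (cardFactors (Nat.ofBits (fun j : Fin (2 * n₁) => Sum.elim r c (π₁.symm j)) +
        2 ^ (2 * n₁) * H + 1)) with h | h
  · left; rw [h]; norm_num
  · right; rw [h]; norm_num

/-- ★ **`LiouvilleCutRank` ⟺ unboundedly many distinct row patterns in one block.**  The crux holds
iff for every `D` there is a scale `n₁` such that for every balanced cut `π₁` of `2n₁` positions
SOME aligned `4^{n₁}`-block of `λ` shows at least `D` distinct row patterns
`c ↦ λ(4^{n₁} H + N_{π₁}(r, c) + 1)` (`r` ranging over the `2^{n₁}` row assignments): `rank ≤`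
number of distinct rows, and a `±1` matrix with `R` distinct rows has `R ≤ 2^{rank}`
(`LiouvilleSarnakAligned.card_image_row_le_two_pow_rank`), so `D = 2^W` distinct rows give rank
`≥ W`. [folklore] -/
theorem liouvilleCutRank_iff_oneBlock_distinctRows :
    LiouvilleCutRank ↔
      ∀ D : ℕ, ∃ n₁ : ℕ, ∀ π₁ : Fin n₁ ⊕ Fin n₁ ≃ Fin (2 * n₁), ∃ H : ℕ,
        D ≤ (Finset.univ.image fun r : Fin n₁ → Bool => fun c : Fin n₁ → Bool =>
          (((liouville (Nat.ofBits (fun j : Fin (2 * n₁) => Sum.elim r c (π₁.symm j)) +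
            2 ^ (2 * n₁) * H + 1) : ℤ) : ℂ))).card := by
  classical
  rw [liouvilleCutRank_iff_oneBlock]
  constructor
  · intro h D
    obtain ⟨n₁, hn₁⟩ := h D
    refine ⟨n₁, fun π₁ => ?_⟩
    obtain ⟨H, hH⟩ := hn₁ π₁
    refine ⟨H, hH.trans ?_⟩
    exact (rank_le_card_image_row _).trans (by rfl)
  · intro h W
    obtain ⟨n₁, hn₁⟩ := h (2 ^ W)
    refine ⟨n₁, fun π₁ => ?_⟩
    obtain ⟨H, hH⟩ := hn₁ π₁
    refine ⟨H, ?_⟩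
    have hle := hH.trans (card_image_row_le_two_pow_rank _ (blockMatrix_entry_eq_or n₁ H π₁))
    exact (Nat.pow_le_pow_iff_right Nat.one_lt_two).mp hle

end Summit.ValiantsHypothesis.ValiantsHypothesis.Theorems.LiouvilleSarnakLiouvilleCutRank.OneBlock
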